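import Mathlib.MeasureTheory.Function.ContinuousMapDense
import Literature.Barriers.AnomalousDissipation.CodimensionOneRigiditySmoothing
import HarnessLib

/-!
# Smooth `L¹(μ)`-approximation on `ℝ × T^d` (patching step of De Rosa–Inversi 2024, Thm. 1.2)

Support file for the discharge of the named fact
`Literature.Barriers.AnomalousDissipation.DeRosaInversi2024_thm12` (`CodimensionOneRigidity.lean`),
seat B (independent assembly). In the last step of the proof of De Rosa–Inversi 2024, Thm. 1.2
(§4 with Prop. 2.8) the Alberti kernel has to be adapted to the local direction `M(x,t)` of
`∇u`; in the partition-of-unity form of that step one splits the test function `ψ = ∑ₖ χₖ ψ`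
with smooth `χₖ` close in `L¹(μ)` to the indicator of the set where the `k`-th kernel of a finite
Alberti family is optimal. This file supplies the approximation: for a finite Borel measure `μ`
on `ℝ × T^d`, every `μ`-integrable real function is within `κ` in `L¹(μ)` of a smooth
space–time function vanishing outside a compact time interval (Lusin/regularity: Mathlib's
`Integrable.exists_hasCompactSupport_integral_sub_le`, then uniform smoothing
`exists_smooth_near`). Everything is proved; theorems only.

## References

* L. De Rosa, M. Inversi, Comm. Math. Phys. 405 (2024), Prop. 2.8 and §4 (arXiv:2307.09189).
* W. Rudin, *Real and Complex Analysis*, 3rd ed., Thm. 3.14 (`C_c` dense in `L¹(μ)`).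
-/

noncomputable section

open MeasureTheory TopologicalSpace Set Function Filter Topology
open scoped ENNReal NNReal ContDiff

namespace Literature.Barriers.AnomalousDissipation

namespace CodimensionOneRigidity

namespace Patch

open Literature.Analysis Literature.Analysis.FunctionSpaces

variable {d : Type*} [Fintype d]

/-- A smooth space–time function vanishing outside a compact time interval is `μ`-integrable for
every finite measure `μ` on `ℝ × T^d` (it is continuous and bounded). [folklore] -/
theorem integrable_uncurry_of_smooth {μ : Measure (ℝ × UnitAddTorus d)} [IsFiniteMeasure μ]
    {χ : ℝ → UnitAddTorus d → ℝ} (hχ : ContDiff ℝ ∞ (Torus.stLift χ)) {a b : ℝ}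
    (hab : ∀ t ∉ Icc a b, χ t = 0) : Integrable (uncurry χ) μ := by
  obtain ⟨hc, C, hC⟩ := continuous_uncurry_and_bounded hχ hab
  exact Integrable.mono' (integrable_const C) hc.aestronglyMeasurable (ae_of_all _ hC)

/-- **Smooth functions are dense in `L¹(μ)`** for a finite Borel measure `μ` on `ℝ × T^d`, within
the class of smooth space–time functions vanishing outside a compact time interval: for
`f ∈ L¹(μ)` and `κ > 0` there is such a `χ` with `∫ |f - χ| dμ ≤ κ`
(Rudin, RCA, Thm. 3.14, then mollification). [folklore] -/
theorem exists_smooth_integral_sub_le {μ : Measure (ℝ × UnitAddTorus d)} [IsFiniteMeasure μ]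
    {f : ℝ × UnitAddTorus d → ℝ} (hf : Integrable f μ) {κ : ℝ} (hκ : 0 < κ) :
    ∃ χ : ℝ → UnitAddTorus d → ℝ, ContDiff ℝ ∞ (Torus.stLift χ) ∧
      (∃ a b : ℝ, ∀ t ∉ Icc a b, χ t = 0) ∧ Continuous (uncurry χ) ∧
      Integrable (uncurry χ) μ ∧ ∫ q, |f q - χ q.1 q.2| ∂μ ≤ κ := by
  obtain ⟨g, hgc, hgf, hgcont, hgi⟩ := hf.exists_hasCompactSupport_integral_sub_le (half_pos hκ)
  set m : ℝ := (μ univ).toReal with hm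
  have hm0 : 0 ≤ m := ENNReal.toReal_nonneg
  set δ : ℝ := κ / 2 / (m + 1) with hδdef
  have hδ : 0 < δ := by positivity
  obtain ⟨χ, hχs, ⟨a, b, hab⟩, hχg⟩ := exists_smooth_near hgcont hgc hδ
  have hχi : Integrable (uncurry χ) μ := integrable_uncurry_of_smooth hχs hab
  have hχc : Continuous (uncurry χ) := (continuous_uncurry_and_bounded hχs hab).1
  refine ⟨χ, hχs, ⟨a, b, hab⟩, hχc, hχi, ?_⟩
  have hpt : ∀ q, |f q - χ q.1 q.2| ≤ ‖f q - g q‖ + δ := fun q => by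
    have h1 : |f q - χ q.1 q.2| ≤ |f q - g q| + |g q - χ q.1 q.2| := abs_sub_le _ _ _
    have h2 : |g q - χ q.1 q.2| ≤ δ := by
      rw [abs_sub_comm]
      exact hχg q.1 q.2
    rw [Real.norm_eq_abs]
    linarith
  have hint : Integrable (fun q => ‖f q - g q‖ + δ) μ := (hf.sub hgi).norm.add (integrable_const δ)
  calc ∫ q, |f q - χ q.1 q.2| ∂μ ≤ ∫ q, (‖f q - g q‖ + δ) ∂μ := by
        refine integral_mono_of_nonneg (ae_of_all _ fun q => abs_nonneg _) hint (ae_of_all _ hpt)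
    _ = (∫ q, ‖f q - g q‖ ∂μ) + δ * m := by
        have h1 : Integrable (fun q => ‖f q - g q‖) μ := (hf.sub hgi).norm
        rw [integral_add h1 (integrable_const δ), integral_const, smul_eq_mul, hm, Measure.real,
          mul_comm]
    _ ≤ κ / 2 + κ / 2 := by
        refine add_le_add hgf ?_
        rw [hδdef]
        rw [div_mul_eq_mul_div, div_le_iff₀ (by positivity)]
        nlinarith
    _ = κ := by ring

/-- **Smooth approximation of indicators**: for a finite Borel measure `μ` on `ℝ × T^d`, a
measurable set `E` and `κ > 0` there is a smooth space–time `χ` vanishing outside a compact time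
interval with `∫ |𝟙_E - χ| dμ ≤ κ`. [folklore] -/
theorem exists_smooth_integral_indicator_sub_le {μ : Measure (ℝ × UnitAddTorus d)}
    [IsFiniteMeasure μ] {E : Set (ℝ × UnitAddTorus d)} (hE : MeasurableSet E) {κ : ℝ}
    (hκ : 0 < κ) :
    ∃ χ : ℝ → UnitAddTorus d → ℝ, ContDiff ℝ ∞ (Torus.stLift χ) ∧
      (∃ a b : ℝ, ∀ t ∉ Icc a b, χ t = 0) ∧ Continuous (uncurry χ) ∧
      Integrable (uncurry χ) μ ∧ ∫ q, |E.indicator (fun _ => (1 : ℝ)) q - χ q.1 q.2| ∂μ ≤ κ :=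
  exists_smooth_integral_sub_le ((integrable_const (1 : ℝ)).indicator hE) hκ

end Patch

end CodimensionOneRigidity

end Literature.Barriers.AnomalousDissipation

end
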